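import Literature.Geometry.Lorentzian.SubdevelopmentCausalConvexity
import Literature.Geometry.Lorentzian.IdealPoints
import HarnessLib

/-!
# Enlarging a globally hyperbolic subregion by a globally hyperbolic neighbourhood of a hypersurface
# in its closure (the last step of Sbierski 2016, §3.2, proof of Thm. 12)

J. Sbierski, *On the existence of a maximal Cauchy development for the Einstein equations: a
dezornification*, Ann. Henri Poincaré 17 (2016) 301–329 = arXiv:1309.7591v3, §3.2, end of the
proof of Theorem 12 (arXiv numbering; Ann. Henri Poincaré Thm. 3.5), having restarted the local
uniqueness theorem from a spacelike hypersurface `S ⊆ Ū` through a boundary point of the common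
globally hyperbolic development `U` and obtained a globally hyperbolic development `N` of `S`:

> *"Also note that `U ∪ N` is globally hyperbolic with Cauchy hypersurface `ι(M̄)`: consider a
> point `r` on an inextendible timelike curve `γ` in `U ∪ N`. If `r` is in `N ∖ U`, the curve `γ`
> must intersect `S`, since `S` is a Cauchy hypersurface in `N`. The choice of `τ₀` then implies
> that `γ` must also enter `U`. So without loss of generality we can assume that there exists a
> point `r` on `γ` that lies in `U`. But since `U` is globally hyperbolic with Cauchy hypersurface
> `ι(M̄)`, it now follows that `γ` must intersect `ι(M̄)`. Moreover, `γ` cannot intersect `ι(M̄)`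
> more than once, since `ι(M̄)` is also a Cauchy hypersurface for `M`."*

We prove this in the pure causal setting of `SubdevelopmentTimelikeEntry.lean` /
`SubdevelopmentCausalConvexity.lean`: `(M, g, τ)` a time-oriented Lorentzian manifold (Hausdorff,
second countable, without boundary, finite-dimensional, `C²` metric) with a Cauchy hypersurface
`S`; `U ⊆ M` open with `S ∩ U` a Cauchy hypersurface of `(U, g|_U, τ|_U)`; `N ⊆ M` open and
`S' ⊆ M` with `S' ∩ N` a Cauchy hypersurface of `(N, g|_N, τ|_N)`; and **`S' ⊆ closure U`**. Then
`S ∩ (U ∪ N)` is a Cauchy hypersurface of `(U ∪ N, g|_{U ∪ N}, τ|_{U ∪ N})`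
(`LorentzianMetric.IsCauchyHypersurface.restrict_sup_of_subset_closure`).

The only property of Sbierski's `S = τ_q⁻¹(τ₀) ∩ W ∩ I⁺(ι(M̄))` that enters ("the choice of `τ₀`")
is `S ⊆ Ū`: an endless timelike curve `γ` of `U ∪ N` lying in `N ∖ U` is endless in `N`, so it
meets `S'` at a point `p ∈ closure U`; `p ∉ S` lies in `I⁺(S)` or in `I⁻(S)`
(`IsCauchyHypersurface.mem_chronologicalFuture_union_chronologicalPast`), and then the points of
`γ` slightly before (resp. after) `p` lie in `U` — no timelike entry into `U` from `J⁺(S) ∖ U` and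
no timelike exit from `U` into `J⁻(S) ∖ U`, in the closure forms of
`IsAchronal.mem_opens_of_mem_closure_of_mem_chronologicalFuture` /
`IsAchronal.mem_opens_of_mem_causalPast_of_mem_chronologicalFuture` (`S` is achronal as a Cauchy
hypersurface). Once `γ` has a point in `U`, its connected piece inside `U` is an endless timelike
curve of `U` and crosses `S` (`IsCauchyHypersurface.exists_mem_connectedComponentIn_of_le`, the
crossing lemma of `CauchyHypersurfaceOpensIntersection.lean` for curves of an open sub-spacetime
`W ⊇ V` rather than of `M`); at most one crossing holds for any timelike curve of any open
sub-spacetime (`IsCauchyHypersurface.eq_of_mem_of_mem_opens`). No hypothesis `S ⊆ U`, `S' ⊆ N` or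
`S' ⊆ J⁺(S)` is needed.

Everything is proved; no definitions, no named facts (D-0026). Consumer: the assembly of
Sbierski's Theorem 12 (`Literature.Geometry.Lorentzian.sbierski_commonDevelopment_lt_of_hasCorrespondingBoundaryPoints`,
`CommonDevelopmentProperExtension.lean`), where `U = 𝔠.opens` is a common globally hyperbolic
development and `N` the development of the restarting hypersurface.

## References

* J. Sbierski, Ann. Henri Poincaré 17 (2016) 301–329 = arXiv:1309.7591v3, §3.2, proof of
  Thm. 12 (arXiv numbering), last paragraph. [Sbierski2016AHP]
* B. O'Neill, *Semi-Riemannian geometry with applications to relativity*, Academic Press 1983,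
  Ch. 14, Lemma 14.3, Def. 14.28, Lemma 14.29. [ONeillSemiRiemannian1983]
-/

noncomputable section

open Set Filter Function TopologicalSpace Topology
open scoped Manifold ContDiff Topology

namespace Literature.Geometry.Lorentzian

section Opens

variable {E : Type*} [NormedAddCommGroup E] [NormedSpace ℝ E] {H : Type*} [TopologicalSpace H]
  {I : ModelWithCorners ℝ E H} {n : ℕ∞ω} {M : Type*} [TopologicalSpace M] [ChartedSpace H M]
  [IsManifold I ∞ M]

omit [IsManifold I ∞ M] in
/-- The parameter set of a past endless curve has no least element: before every parameter there
is an earlier one (time dual of `IsFutureEndless.exists_gt`, `IdealPoints.lean`). Hawking–Ellis 1973, §6.2, p. 184.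
[cite: HawkingEllis1973CUP, §6.2, p. 184] -/
theorem IsPastEndless.exists_lt {γ : ℝ → M} {s : Set ℝ} (h : IsPastEndless γ s) {t : ℝ}
    (ht : t ∈ s) : ∃ t' ∈ s, t' < t := by
  by_contra hcon
  push Not at hcon
  refine h.2 (γ t) ?_
  exact tendsto_atBot_of_eventually_const (i₀ := (⟨t, ht⟩ : s)) fun i hi ↦
    congrArg γ (le_antisymm hi (hcon i i.2))

namespace LorentzianMetric

variable {g : LorentzianMetric I n M} {τ : TimeOrientation g}
  (hres : PseudoRiemannianMetric.contMDiff_restrict (I := I) (n := n) (M := M))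
  (hτ : τ.contMDiff_restrict)

/-! ### The crossing lemma for curves of a larger open sub-spacetime -/

/-- **The piece of an endless timelike curve of an open sub-spacetime `W` inside a smaller open
globally hyperbolic sub-spacetime `V ⊆ W` crosses the Cauchy hypersurface of `V`.** Let `V ≤ W` be
open subsets of `M`, `S ∩ V` a Cauchy hypersurface of `(V, g|_V, τ|_V)`, and `γ` an endless
timelike curve of `(W, g|_W, τ|_W)` on the parameter interval `s` with `γ t₀ ∈ V`. Then `γ` meets
`S` at some parameter of the connected component of `t₀` in `{t ∈ s | γ t ∈ V}`: that piece is an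
endless timelike curve of `V` (`not_hasFutureEndpoint_connectedComponentIn` and its time dual,
applied in the Hausdorff space `W`). The version of
`IsCauchyHypersurface.exists_mem_connectedComponentIn` (`W = M`) needed when `γ` is only a curve
of a sub-spacetime; Sbierski 2016, §3.1, proof of Thm. 10 ("the corresponding curve segment in
`U_α` can be considered to be an inextendible timelike curve in `U_α`") and §3.2, end of the proof
of Thm. 12. [cite: Sbierski2016AHP, §3.1, proof of Thm. 10 and §3.2, proof of Thm. 12 (arXiv numbering)] -/
theorem IsCauchyHypersurface.exists_mem_connectedComponentIn_of_le [T2Space M] {S : Set M}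
    {V W : Opens M} (hVW : V ≤ W)
    (hV : (g.restrict hres V).IsCauchyHypersurface (τ.restrict hres hτ V) (Subtype.val ⁻¹' S))
    {γ : ℝ → W} {s : Set ℝ}
    (hγ : (g.restrict hres W).IsEndlessTimelikeCurve (τ.restrict hres hτ W) γ s) {t₀ : ℝ}
    (ht₀ : t₀ ∈ s) (hγt₀ : (γ t₀ : M) ∈ V) :
    ∃ t₁ ∈ connectedComponentIn (s ∩ (Subtype.val ∘ γ) ⁻¹' (V : Set M)) t₀, (γ t₁ : M) ∈ S := by
  classical
  obtain ⟨hs, hγt, hγf, hγp⟩ := hγ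
  have hγM : g.IsFutureTimelikeCurveOn τ (Subtype.val ∘ γ) s :=
    (isFutureTimelikeCurveOn_restrict_iff g τ hres hτ W).1 hγt
  have hcontW : ∀ t ∈ s, ContinuousAt γ t := fun t ht ↦ (hγt t ht).1.continuousAt
  -- the open subset `V` seen inside `W`
  set O : Set W := Subtype.val ⁻¹' (V : Set M) with hO
  have hOo : IsOpen O := V.2.preimage continuous_subtype_val
  have hpre : s ∩ (Subtype.val ∘ γ) ⁻¹' (V : Set M) = s ∩ γ ⁻¹' O := rfl
  rw [hpre]
  set J := connectedComponentIn (s ∩ γ ⁻¹' O) t₀ with hJ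
  have hi : γ t₀ ∈ O := hγt₀
  have ht₀J : t₀ ∈ J := mem_connectedComponentIn ⟨ht₀, hi⟩
  have hJsub : J ⊆ s ∩ γ ⁻¹' O := connectedComponentIn_subset _ _
  have hJord : J.OrdConnected :=
    isPreconnected_iff_ordConnected.1 isPreconnected_connectedComponentIn
  -- the piece, as a curve of `V`
  set δ : ℝ → V := fun t ↦ if h : (γ t : M) ∈ V then ⟨γ t, h⟩ else ⟨γ t₀, hγt₀⟩ with hδ
  have hδval : ∀ t ∈ J, (δ t : M) = γ t := fun t ht ↦ by
    have hmem : (γ t : M) ∈ V := (hJsub ht).2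
    show Subtype.val (if h : (γ t : M) ∈ V then (⟨γ t, h⟩ : V) else (⟨γ t₀, hγt₀⟩ : V)) = γ t
    rw [dif_pos hmem]
  have hδev : ∀ t ∈ J, (Subtype.val ∘ δ) =ᶠ[𝓝 t] (Subtype.val ∘ γ) := fun t ht ↦ by
    have hmem : γ ⁻¹' O ∈ 𝓝 t :=
      (hcontW t (hJsub ht).1).preimage_mem_nhds (hOo.mem_nhds (hJsub ht).2)
    filter_upwards [hmem] with t' ht'
    simp only [comp_apply, hδ, dif_pos (show (γ t' : M) ∈ V from ht')]
  -- `δ` is a future timelike curve of `V` on `J`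
  have hδt : (g.restrict hres V).IsFutureTimelikeCurveOn (τ.restrict hres hτ V) δ J := by
    rw [isFutureTimelikeCurveOn_restrict_iff]
    intro t ht
    obtain ⟨hd, h1, h2⟩ := hγM t (hJsub ht).1
    have hveq : velocity I (Subtype.val ∘ δ) t = velocity I (Subtype.val ∘ γ) t :=
      DFunLike.congr_fun (hδev t ht).mfderiv_eq (1 : ℝ)
    refine ⟨(hδev t ht).mdifferentiableAt_iff.2 hd, ?_, ?_⟩
    · change g.val (δ t : M) (velocity I (Subtype.val ∘ δ) t) (velocity I (Subtype.val ∘ δ) t) < 0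
      rw [hveq, hδval t ht]
      exact h1
    · change (g.val (δ t : M) (velocity I (Subtype.val ∘ δ) t)
          (velocity I (Subtype.val ∘ δ) t) ≤ 0 ∧ velocity I (Subtype.val ∘ δ) t ≠ 0) ∧
        g.val (δ t : M) (τ.vectorField (δ t : M)) (velocity I (Subtype.val ∘ δ) t) < 0
      rw [hveq, hδval t ht]
      exact h2
  -- `δ` is endless on `J` (in `V`): an endpoint in `V` would be an endpoint of the piece of `γ`
  -- in `W`, excluded by `not_hasFutureEndpoint_connectedComponentIn` (and its time dual)
  have hδf : IsFutureEndless δ J := by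
    refine ⟨⟨t₀, ht₀J⟩, fun q hq ↦ ?_⟩
    have h1 : HasFutureEndpoint (Subtype.val ∘ δ) J (q : M) :=
      hasFutureEndpoint_subtypeVal_comp_iff.2 hq
    have h2 : HasFutureEndpoint (Subtype.val ∘ γ) J (q : M) := by
      refine h1.congr fun t ↦ ?_
      exact hδval t t.2
    have h3 : HasFutureEndpoint γ J ⟨q, hVW q.2⟩ :=
      hasFutureEndpoint_subtypeVal_comp_iff.1 h2
    exact not_hasFutureEndpoint_connectedComponentIn hs hcontW hγf hOo ht₀ hi
      (p := ⟨q, hVW q.2⟩) q.2 h3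
  have hδp : IsPastEndless δ J := by
    refine ⟨⟨t₀, ht₀J⟩, fun q hq ↦ ?_⟩
    have h1 : HasPastEndpoint (Subtype.val ∘ δ) J (q : M) :=
      hasPastEndpoint_subtypeVal_comp_iff.2 hq
    have h2 : HasPastEndpoint (Subtype.val ∘ γ) J (q : M) := by
      refine h1.congr fun t ↦ ?_
      exact hδval t t.2
    have h3 : HasPastEndpoint γ J ⟨q, hVW q.2⟩ :=
      hasPastEndpoint_subtypeVal_comp_iff.1 h2
    exact not_hasPastEndpoint_connectedComponentIn hs hcontW hγp hOo ht₀ hi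
      (p := ⟨q, hVW q.2⟩) q.2 h3
  -- hence `δ` meets `S`
  obtain ⟨t₁, ⟨ht₁J, ht₁S⟩, -⟩ := hV δ J ⟨hJord, hδt, hδf, hδp⟩
  refine ⟨t₁, ht₁J, ?_⟩
  have h : (δ t₁ : M) ∈ S := ht₁S
  rwa [hδval t₁ ht₁J] at h

/-! ### The union `U ∪ N` -/

/-- **Enlarging a globally hyperbolic subregion** (Sbierski 2016, §3.2, last paragraph of the
proof of Thm. 12). Let `S` be a Cauchy hypersurface of `(M, g, τ)` (Hausdorff, second countable,
without boundary, finite-dimensional, `C²`), `U ⊆ M` open with `S ∩ U` a Cauchy hypersurface of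
`(U, g|_U, τ|_U)`, and `N ⊆ M` open, `S' ⊆ M`, with `S' ∩ N` a Cauchy hypersurface of
`(N, g|_N, τ|_N)` and `S' ⊆ closure U`. Then `S ∩ (U ∪ N)` is a Cauchy hypersurface of
`(U ∪ N, g|_{U ∪ N}, τ|_{U ∪ N})`. *"Consider a point `r` on an inextendible timelike curve `γ`
in `U ∪ N`. If `r` is in `N ∖ U`, the curve `γ` must intersect `S`, since `S` is a Cauchy
hypersurface in `N` … `γ` must also enter `U` … since `U` is globally hyperbolic with Cauchy
hypersurface `ι(M̄)`, it now follows that `γ` must intersect `ι(M̄)`. Moreover, `γ` cannot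
intersect `ι(M̄)` more than once, since `ι(M̄)` is also a Cauchy hypersurface for `M`."* The
entry into `U` uses only `S' ⊆ Ū`: the crossing point `p ∈ S' ∖ S` lies in `I⁺(S)` or `I⁻(S)`,
and a point of `γ` just before (after) `p` lies in `U` by
`IsAchronal.mem_opens_of_mem_closure_of_mem_chronologicalFuture`
(`IsAchronal.mem_opens_of_mem_causalPast_of_mem_chronologicalFuture`).
[cite: Sbierski2016AHP, §3.2, proof of Thm. 12, last paragraph (arXiv numbering)] -/
theorem IsCauchyHypersurface.restrict_sup_of_subset_closure [T2Space M] [SecondCountableTopology M]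
    [BoundarylessManifold I M] [FiniteDimensional ℝ E] (hn : 2 ≤ n) {S : Set M}
    (hS : g.IsCauchyHypersurface τ S) {U N : Opens M}
    (hU : (g.restrict hres U).IsCauchyHypersurface (τ.restrict hres hτ U) (Subtype.val ⁻¹' S))
    {S' : Set M}
    (hN : (g.restrict hres N).IsCauchyHypersurface (τ.restrict hres hτ N) (Subtype.val ⁻¹' S'))
    (hS'U : S' ⊆ closure (U : Set M)) :
    (g.restrict hres (U ⊔ N)).IsCauchyHypersurface (τ.restrict hres hτ (U ⊔ N))
      (Subtype.val ⁻¹' S) := by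
  intro γ s hγ
  have hγM : g.IsFutureTimelikeCurveOn τ (Subtype.val ∘ γ) s :=
    (isFutureTimelikeCurveOn_restrict_iff g τ hres hτ (U ⊔ N)).1 hγ.2.1
  -- it suffices to find one crossing: at most one holds in `M`
  suffices hex : ∃ t ∈ s, (γ t : M) ∈ S by
    obtain ⟨t₁, ht₁, h₁⟩ := hex
    exact ⟨t₁, ⟨ht₁, h₁⟩, fun t₂ ht₂ ↦
      IsCauchyHypersurface.eq_of_mem_of_mem_opens hres hτ hn hS hγ.1 hγ.2.1 ht₂.1 ht₁ ht₂.2 h₁⟩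
  -- a point of `γ` in `U` gives a crossing (the piece in `U` is endless in `U`)
  have key : ∀ t ∈ s, (γ t : M) ∈ U → ∃ t' ∈ s, (γ t' : M) ∈ S := fun t ht htU ↦ by
    obtain ⟨t₁, ht₁, h⟩ :=
      IsCauchyHypersurface.exists_mem_connectedComponentIn_of_le hres hτ le_sup_left hU hγ ht htU
    exact ⟨t₁, (connectedComponentIn_subset _ _ ht₁).1, h⟩
  by_contra hcon
  push Not at hcon
  have hnotU : ∀ t ∈ s, (γ t : M) ∉ U := fun t ht htU ↦ by
    obtain ⟨t', ht', h⟩ := key t ht htU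
    exact hcon t' ht' h
  obtain ⟨t₀, ht₀⟩ := hγ.2.2.1.1
  have ht₀N : (γ t₀ : M) ∈ N := (Opens.mem_sup.1 (γ t₀).2).resolve_left (hnotU t₀ ht₀)
  -- the piece in `N` meets `S'`, at a point of `closure U` off `S`
  obtain ⟨t₁, ht₁J, ht₁S'⟩ :=
    IsCauchyHypersurface.exists_mem_connectedComponentIn_of_le hres hτ le_sup_right hN hγ ht₀ ht₀N
  have ht₁ : t₁ ∈ s := (connectedComponentIn_subset _ _ ht₁J).1
  have hpcl : (γ t₁ : M) ∈ closure (U : Set M) := hS'U ht₁S'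
  have hpS : (γ t₁ : M) ∉ S := hcon t₁ ht₁
  have hSach : g.IsAchronal τ S := IsCauchyHypersurface.isAchronal_holds hn hS
  have hcont : ContinuousAt (Subtype.val ∘ γ) t₁ := (hγM t₁ ht₁).1.continuousAt
  rcases hS.mem_chronologicalFuture_union_chronologicalPast hn hpS with hpI | hpI
  · -- `p ∈ I⁺(S)`: a slightly earlier point of `γ` lies in `I⁺(S)` and `≪ p`, hence in `U`
    have hev : ∀ᶠ t in 𝓝 t₁, (γ t : M) ∈ g.chronologicalFuture τ S :=
      hcont.preimage_mem_nhds ((isOpen_chronologicalFuture_of_boundaryless g τ S).mem_nhds hpI)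
    obtain ⟨t₂, ht₂s, ht₂lt⟩ := IsPastEndless.exists_lt hγ.2.2.2 ht₁
    have h1 : ∀ᶠ t in 𝓝[<] t₁, (γ t : M) ∈ g.chronologicalFuture τ S := nhdsWithin_le_nhds hev
    have h2 : ∀ᶠ t in 𝓝[<] t₁, t ∈ Ioo t₂ t₁ := Ioo_mem_nhdsLT ht₂lt
    obtain ⟨t, htI, ht⟩ := (h1.and h2).exists
    have hts : t ∈ s := hγ.1.out ht₂s ht₁ ⟨ht.1.le, ht.2.le⟩
    have hsub : Icc t t₁ ⊆ s := hγ.1.out hts ht₁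
    have hfut : (γ t₁ : M) ∈ g.chronologicalFuture τ {(γ t : M)} :=
      ⟨γ t, rfl, Subtype.val ∘ γ, t, t₁, ht.2, hγM.mono hsub, rfl, rfl⟩
    have htU : (γ t : M) ∈ U :=
      hSach.mem_opens_of_mem_closure_of_mem_chronologicalFuture hn hres hτ hU
        (chronologicalFuture_subset_causalFuture g τ S htI) hpcl hfut
    exact hnotU t hts htU
  · -- `p ∈ I⁻(S)`: a slightly later point of `γ` lies in `I⁻(S)` and `≫ p`, hence in `U`
    have hev : ∀ᶠ t in 𝓝 t₁, (γ t : M) ∈ g.chronologicalPast τ S :=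
      hcont.preimage_mem_nhds ((isOpen_chronologicalPast_of_boundaryless g τ S).mem_nhds hpI)
    obtain ⟨t₂, ht₂s, ht₂gt⟩ := IsFutureEndless.exists_gt hγ.2.2.1 ht₁
    have h1 : ∀ᶠ t in 𝓝[>] t₁, (γ t : M) ∈ g.chronologicalPast τ S := nhdsWithin_le_nhds hev
    have h2 : ∀ᶠ t in 𝓝[>] t₁, t ∈ Ioo t₁ t₂ := Ioo_mem_nhdsGT ht₂gt
    obtain ⟨t, htI, ht⟩ := (h1.and h2).exists
    have hts : t ∈ s := hγ.1.out ht₁ ht₂s ⟨ht.1.le, ht.2.le⟩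
    have hsub : Icc t₁ t ⊆ s := hγ.1.out ht₁ hts
    have hfut : (γ t : M) ∈ g.chronologicalFuture τ {(γ t₁ : M)} :=
      ⟨γ t₁, rfl, Subtype.val ∘ γ, t₁, t, ht.1, hγM.mono hsub, rfl, rfl⟩
    -- a point of `U` in the open set `I⁻(γ t) ∋ p`
    obtain ⟨y, hyI, hyU⟩ : (g.chronologicalPast τ {(γ t : M)} ∩ (U : Set M)).Nonempty :=
      mem_closure_iff.1 hpcl _ (isOpen_chronologicalPast_of_boundaryless g τ {(γ t : M)})
        (mem_chronologicalPast_of_mem_chronologicalFuture hfut)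
    have htU : (γ t : M) ∈ U :=
      hSach.mem_opens_of_mem_causalPast_of_mem_chronologicalFuture hn hres hτ hU
        (chronologicalFuture_subset_causalFuture g τ.reverse S htI) hyU
        (mem_chronologicalFuture_of_mem_chronologicalPast hyI)
    exact hnotU t hts htU

end LorentzianMetric

end Opens

/-! ### The instance for common globally hyperbolic developments -/

section Developments

universe u

variable {n : ℕ} {X : Type u} [TopologicalSpace X] [ChartedSpace (EuclideanSpace ℝ (Fin n)) X]
  [IsManifold (𝓡 n) ∞ X] [ConnectedSpace X] {D : InitialDataSet (𝓡 n) X}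

namespace CauchyDevelopment

namespace CommonDevelopment

variable {𝒟 𝒟' : CauchyDevelopment D} (𝔠 : CommonDevelopment 𝒟 𝒟')

/-- **Sbierski's enlargement step for a common globally hyperbolic development.** Let `(U, ψ)` be
a common globally hyperbolic development of the Cauchy developments `𝒟`, `𝒟'` (`U = 𝔠.opens`),
`N ⊆ M` open and `S' ⊆ closure U` a set with `S' ∩ N` a Cauchy hypersurface of
`(N, g|_N, τ|_N)`. Then `ι(X)` is a Cauchy hypersurface of the open sub-spacetime `U ∪ N` — the
global-hyperbolicity clause of "`U ∪ N ⊆ M` is a strictly larger CGHD" in the proof of Thm. 12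
(Sbierski 2016, §3.2). [cite: Sbierski2016AHP, §3.2, proof of Thm. 12, last paragraph (arXiv numbering)] -/
theorem isCauchyHypersurface_sup {N : Opens 𝒟.carrier} {S' : Set 𝒟.carrier}
    (hN : (𝒟.metric.restrict PseudoRiemannianMetric.contMDiff_restrict_holds N).IsCauchyHypersurface
      (𝒟.timeOrientation.restrict PseudoRiemannianMetric.contMDiff_restrict_holds
        𝒟.timeOrientation.contMDiff_restrict_holds N) (Subtype.val ⁻¹' S'))
    (hS'U : S' ⊆ closure (𝔠.opens : Set 𝒟.carrier)) :
    (𝒟.metric.restrict PseudoRiemannianMetric.contMDiff_restrict_holds (𝔠.opens ⊔ N)).IsCauchyHypersurface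
      (𝒟.timeOrientation.restrict PseudoRiemannianMetric.contMDiff_restrict_holds
        𝒟.timeOrientation.contMDiff_restrict_holds (𝔠.opens ⊔ N))
      (Subtype.val ⁻¹' range 𝒟.embed) :=
  LorentzianMetric.IsCauchyHypersurface.restrict_sup_of_subset_closure
    PseudoRiemannianMetric.contMDiff_restrict_holds 𝒟.timeOrientation.contMDiff_restrict_holds
    (WithTop.coe_le_coe.mpr le_top) 𝒟.isCauchyHypersurface 𝔠.isCauchyHypersurface hN hS'U

end CommonDevelopment

end CauchyDevelopment

end Developments

end Literature.Geometry.Lorentzian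

end
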